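import Mathlib
import HarnessLib
import Summits.HubbardSuperconductivity.HubbardSuperconductivity.Theorems.KLProgrammeH10TwoPointLimitIsoSymbolInstance
import Summits.HubbardSuperconductivity.HubbardSuperconductivity.Theorems.KLProgrammeKLRegimeSymbolAngularFactorSingle

/-!
# Route `KLProgramme` — engine support, route (L2) symbol layer: the PADDED single-multiplier symbol on `(ℤ/4M) × (ℤ/L)²` — the sampled symbol
# of the engine's torus sums (`IsoTorusBoundAt` convention: time index padded by zero beyond the `2M` kept Matsubara frequencies) IS the sample of
# the continuum symbol `Φ(k₀, p) = Gₙ(k₀² + e_K(p)²)·Z(p)`, and the three-step window on `ℤ/4M`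

Cell `gate-hubbard-kl`, seat p3 (g10); the anisotropic twin of p4's `klIso_padded_eq_symbol` / `isoSymbol_window4` (`…IsoSymbolInstance`), for W1 of
the (E4)ₙ supply of stmt-HubbardSuperconductivity-20437 (the weighted torus bound of ONE level-`n` sector function on the `4M`-grid of the engine's
decay bookkeeping; located risk «(b)-Wt@j≥1», cure W1-MIXED):

* **`klAniso_padded_eq_symbol`** — for `Λ_nβ < π(2M − 3)` and every `q ∈ (ℤ/4M) × (ℤ/L)²`,
  `(if val q₁ < 2M then F_ω(⟨val q₁⟩, q₂) else 0) = Φ(π(1−2M)/β + (2π/β)·val q₁, (2π/L)·q̃₂)`;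
* **`symbol_window₃_padded`** — if `Λβ < π(2M − 5)` then `Λ < |π(1−2M)/β + (2π/β) mm|` for all integers `mm < 3` and `mm ≥ 4M − 3`.

Everything is proved; no definitions, no named facts. [folklore]
-/

noncomputable section

namespace Summit.HubbardSuperconductivity.HubbardSuperconductivity.Theorems.TorusFourierL2

set_option linter.dupNamespace false -- summit = problem name (single-conjunct summit), D-0017

open Set Literature.MathematicalPhysics.QuantumLattice Literature.MathematicalPhysics.QuantumLattice.BandSectorCounting
open Literature.MathematicalPhysics.QuantumLattice.FermiRG Literature.Probability.LatticeModels Literature.Analysis.SpecialFunctions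
open Summit.HubbardSuperconductivity.HubbardSuperconductivity.Theorems.DispersionFlow
open Summit.HubbardSuperconductivity.HubbardSuperconductivity.Theorems.KLRegimeSplit
open Summit.HubbardSuperconductivity.HubbardSuperconductivity.Theorems.KLProgrammeLegKernels
open Summit.HubbardSuperconductivity.HubbardSuperconductivity.Theorems.PerturbedFermiCurve
open scoped Real

section Instance

variable {L M : ℕ} [NeZero L] [NeZero M] {K : TrigPolyC4v} {A : ℝ}
  (hA : ∀ p : Momentum, ∀ j ≤ 2, ‖iteratedFDeriv ℝ j (frameShift K) p‖ ≤ A)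
  {μ e₀ z β : ℝ} (he : 0 < e₀) (hz : 0 < z) (h3 : e₀ + A - μ ≤ 3) (hβ : 0 < β)
  {n : ℕ} (ω : Fin (sectorCount n))
  {Z : (Fin 2 → ℝ) → ℝ}
  (hZ : ∀ p, Z p = gnCutoff ((π + z) ^ 2 / π ^ 2) ((π + z) ^ 2) (p 0 ^ 2) * gnCutoff ((π + z) ^ 2 / π ^ 2) ((π + z) ^ 2) (p 1 ^ 2) *
    (radialCutoffC (1 / 2) (momToComplex p) * sectorWeightCirc n ((ω : ℕ) : ℤ) (polarAngle p)))
  {Φ : ℝ × (Fin 2 → ℝ) → ℂ}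
  (hΦ : ∀ k₀ p, Φ (k₀, p) = ((bgmCutoffSq e₀ ((16 : ℝ) ^ n * (k₀ ^ 2 + frameLevel μ K (WithLp.toLp 2 p) ^ 2)) * Z p : ℝ) : ℂ))
  {Gs : TorusSite 1 (2 * (2 * M)) × TorusSite 2 L → ℂ}
  (hGs : ∀ q, Gs q = if h : (q.1 0).val < 2 * M then klAnisoFamily L M β μ K e₀ n ω (⟨(q.1 0).val, h⟩, q.2) else 0)

include hA h3 he hz hβ hZ hΦ hGs in
omit [NeZero M] in
/-- **The padded anisotropic multiplier IS the sample of the continuum symbol** on all of `(ℤ/4M) × (ℤ/L)²`: for `Λ_n β < π(2M − 3)`,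
`Gs q = Φ(π(1−2M)/β + (2π/β) val q₁, (2π/L) q̃₂)`. [cite: BenfattoGiulianiMastropietro2006, §2.5 (2.45)–(2.48)] -/
theorem klAniso_padded_eq_symbol (hM : klScale e₀ n * β < π * (2 * M - 3)) (q : TorusSite 1 (2 * (2 * M)) × TorusSite 2 L) :
    Gs q = Φ (π * (1 - 2 * M) / β + 2 * π / β * (((q.1 0).val : ℕ) : ℝ), fun j => 2 * π / L * (((q.2 j).valMinAbs : ℤ) : ℝ)) := by
  rw [hGs]
  set c : Fin 2 → ℝ := torusCentredMomentum L q.2 with hc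
  have hcval : c = fun j => 2 * π / L * (((q.2 j).valMinAbs : ℤ) : ℝ) := torusCentredMomentum_eq_valMinAbs q.2
  have he_eq : nambuXiCT L μ K q.2 = frameLevel μ K (WithLp.toLp 2 c) := nambuXiCT_eq_frameLevel L μ K q.2
  have hang : momentumAngle L q.2 = polarAngle c := rfl
  have hΛ : 0 < klScale e₀ n := by rw [klScale]; positivity
  split_ifs with h
  · rw [← hcval, hΦ, klAnisoFamily, bgmMultiplier, matsubaraFreq_val_eq q.1 h, he_eq, hang]
    set k₀ : ℝ := π * (1 - 2 * M) / β + 2 * π / β * (((q.1 0).val : ℕ) : ℝ) with hk₀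
    set u : ℝ := k₀ ^ 2 + frameLevel μ K (WithLp.toLp 2 c) ^ 2 with hu
    congr 1
    have hcπ : ∀ j, |c j| ≤ π := abs_torusCentredMomentum_le_pi L q.2
    have hsq : ∀ j, gnCutoff ((π + z) ^ 2 / π ^ 2) ((π + z) ^ 2) (c j ^ 2) = 1 := fun j =>
      sqCutoff_eq_one hz (by rw [← sq_abs]; exact pow_le_pow_left₀ (abs_nonneg _) (hcπ j) 2)
    rw [hZ c, hsq 0, hsq 1, one_mul, one_mul]
    by_cases hR : (1 : ℝ) / 2 ≤ ‖momToComplex c‖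
    · rw [radialCutoffC_eq_one (by norm_num) hR, one_mul, gnScaleCutoff_sqrt_eq_bgmCutoffSq]
    · have hnot : ¬ (1 : ℝ) ≤ ‖momToComplex c‖ := fun h1 => hR (by linarith)
      have hbig : e₀ < |frameLevel μ K (WithLp.toLp 2 c)| := by
        by_contra hle
        exact hnot (one_le_norm_of_frameBand_le hA h3 (not_lt.1 hle))
      have h1 : gnScaleCutoff 4 e₀ (-(n : ℤ)) (Real.sqrt u) = 0 := gnScaleCutoff_eq_zero_of_band_gt he n hbig
      have h1' : bgmCutoffSq e₀ ((16 : ℝ) ^ n * u) = 0 := by rw [← gnScaleCutoff_sqrt_eq_bgmCutoffSq]; exact h1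
      rw [h1, h1']; ring
  · push Not at h
    rw [← hcval, hΦ]
    have hwin := window_of_le_val hβ hM q.1 h
    have hu : klScale e₀ n ^ 2 < (π * (1 - 2 * M) / β + 2 * π / β * (((q.1 0).val : ℕ) : ℝ)) ^ 2 +
        frameLevel μ K (WithLp.toLp 2 c) ^ 2 := by
      have h1 : klScale e₀ n ^ 2 < (π * (1 - 2 * M) / β + 2 * π / β * (((q.1 0).val : ℕ) : ℝ)) ^ 2 := by
        have := sq_lt_sq' (by linarith [abs_nonneg (π * (1 - 2 * M) / β + 2 * π / β * (((q.1 0).val : ℕ) : ℝ))]) hwin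
        rwa [sq_abs] at this
      nlinarith
    obtain ⟨d, -, hd1, hd2⟩ := exists_abs_derivs_bgmCutoffSq_le he
    rw [(scaleProfile_bounds he n hd1 hd2).2.2.2.2 _ hu]; simp

include hβ in
omit [NeZero M] in
/-- **Three-step window on `ℤ/4M`**: if `Λβ < π(2M − 5)` then `Λ < |π(1−2M)/β + (2π/β) mm|` for all integers `mm < 3` and `mm ≥ 4M − 3`. [folklore] -/
theorem symbol_window₃_padded {Λ : ℝ} (hM : Λ * β < π * (2 * M - 5)) (mm : ℤ)
    (hm : mm < 3 ∨ ((2 * (2 * M) : ℕ) : ℤ) ≤ mm + 3) : Λ < |π * (1 - 2 * M) / β + 2 * π / β * (mm : ℝ)| := by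
  have hπ := Real.pi_pos
  have e : π * (1 - 2 * M) / β + 2 * π / β * (mm : ℝ) = π * (2 * (mm : ℝ) + 1 - 2 * M) / β := by field_simp; ring
  rw [e, abs_div, abs_of_pos hβ, lt_div_iff₀ hβ, abs_mul, abs_of_pos hπ]
  refine lt_of_lt_of_le hM (mul_le_mul_of_nonneg_left ?_ hπ.le)
  rcases hm with hm | hm
  · have hm' : (mm : ℝ) ≤ 2 := by exact_mod_cast (by omega : mm ≤ 2)
    rw [le_abs]; right; linarith
  · have hm' : (4 * (M : ℝ)) - 3 ≤ (mm : ℝ) := by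
      have : (4 * M : ℤ) - 3 ≤ mm := by push_cast at hm ⊢; omega
      exact_mod_cast this
    have hM0 : (0 : ℝ) ≤ M := Nat.cast_nonneg M
    rw [le_abs]; left; linarith

end Instance

end Summit.HubbardSuperconductivity.HubbardSuperconductivity.Theorems.TorusFourierL2

end
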